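import Summits.KontsevichZagierPeriods.Zeta5Search.Barrier.ConeGammaCuspPatternOriented

/-!
# ζ(5) search — BARRIER: THE CANONICAL PERIOD PATTERN FUNCTION — the junction-count gauge and its cone certificate with NO structural hypothesis

HONEST FRAMING (cell `pub-zeta5`): systematic search; no irrationality claim unless kernel-certified. MODEL objects
under Brown–Zudilin's (28)+(30) accounting ([BZ22] = arXiv:2210.03391; (28) observed, not proved); nothing here is a
statement about `ζ(5)`, any `γ` of record, the cone's supremum (C2 OPEN) or the value / sign of the cusp slope, of a
chamber weight or of a junction count at a named direction (DATA of the cell); NO certificate instance is asserted for any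
named direction (ascent directions exist at all four — DATA); S-E stays CONJECTURED; records in print UNMOVED. Prover P2 g33,
item «THE CANONICAL PATTERN FUNCTION», file (3) of 3 (theorems only).

With file (1)'s canonical junction pattern functions `patternN a b_m` (members of `b_m`: `b_m·h_k(a) ∈ ℤ`) the PERIOD
PATTERN FUNCTION of P2 g31 is ONE explicit set function, `F(A) = Σ_{m<#bkpts−1} patternN a b_m A` on all `A ⊆` the 28 forms
(hypothesis shape `hF` below: an abbreviation, `F` is determined), and the three links of the cusp chain are THEOREMS:
`hf` (file (1) `torusN_bkpt_add_eq_patternN`), `hF` with the member finsets (`patternN_inter_eq`), `hspread` (file (2)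
`patternN_spread_le_one`). Consequently, with ONLY «all 28 forms positive, `T > 0` a period» as hypotheses:
* **`cuspSlope_eq_lovasz_canonical`** — `σ(δ)` is the Lovász extension of THIS `F` at the 28 rates (P2 g31 (1));
  **`cuspSlope_eq_greedy_canonical_of_refines`** — on the closed chamber of a generic `δ₀`, `σ(δ) = Σ_k W_k(δ₀)·r_k(δ)` with
  the CANONICAL chamber weights `W_k(δ₀) = F(P≤(k)) − F(P<(k))`; **`canonical_weight_bounds`** — `0 ≤ W_k ≤ T·h_k(a)` on `F`,
  `−T·h_k(a) ≤ W_k ≤ 0` off `F`; `canonical_greedy_sum_eq_zero` — `Σ_k W_k = 0`;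
* **`cuspSlope_le_greedy_add_countGauge_canonical`** / **`greedy_sub_countGauge_le_cuspSlope_canonical`** — for EVERY
  generic reference `δ₀` and EVERY displacement `δ`:
  `|σ(δ) − Σ_k W_k(δ₀) r_k(δ)| ≤ Σ_{walls {k,l} inverted between δ₀ and δ} J_{kl}·|r_k(δ) − r_l(δ)|`,
  `J_{kl} = #{m : b_m·h_k(a) ∈ ℤ ∧ b_m·h_l(a) ∈ ℤ}` the number of junctions of the period on the wall — P2 g32's junction-count
  gauge with its one structural hypothesis (`hspread`) DISCHARGED: nothing but the cell's own objects in the statement;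
* **`cuspSlope_nonpos_on_cone_of_generators_canonical`** — the NO-ASCENT CONE CERTIFICATE in the same unconditional form:
  finitely many rational checks `Σ_k W_k(δ₀) r_k(g_j) + Σ_{ρ₀k<ρ₀l} J_{kl}(r_k(g_j) − r_l(g_j))⁺ ≤ 0` at generators `g_j` give
  `σ ≤ 0` on the whole cone `Σ t_j g_j`, `t ≥ 0`.
DESK (DATA, `HOME/pub-zeta5-p2/g33/alg/`): at record/41, flag/60, argmax-120, t*/480 only 12 / 8 / 4 / 12 of the 204 / 212 / 588 /
2,750 junctions of a period have linearly DEPENDENT member forms (all others realise every member pattern, so no extension was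
ever involved there); exact realisable-pattern counts at the small dependent junctions in the README. NOT here: any `W`, `J`,
`σ` or certificate at a named direction; the covering computation; `γ`, C2, S-E, `ζ(5)`.
-/

noncomputable section

open Set MeasureTheory Finset
open scoped Topology

namespace Summit.KontsevichZagierPeriods.Zeta5Search.Barrier.ConeGamma

/-! ### The three links of the chain are theorems for the canonical data -/

open scoped Classical in
/-- **`hf` holds**: at every junction `b_m` of the period the saving near `θ_{b_m}` is the canonical pattern function of the
member-sign pattern (members of `b_m` = `{k : b_m·h_k(a) ∈ ℤ}`). -/
theorem canonical_junction_agreement (a : Dir) (T : ℝ) :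
    ∀ m, m + 1 < (bkpts a T).card → ∀ Δ : Fin 8 → ℝ, (∀ k, |phiForm Δ k| < 1) →
      (∀ k, |phiForm Δ k| < wallDist a T) →
        (torusN (bkpt a T m • sParam a + Δ) : ℝ) =
          ((patternN a (bkpt a T m) ((Finset.univ.filter fun k => ∃ z : ℤ, bkpt a T m * h28 a k = z).filter
            fun k => 0 ≤ phiForm Δ k) : ℤ) : ℝ) :=
  fun _ hm Δ hΔ1 hΔ2 => torusN_bkpt_add_eq_patternN_real (bkpt_mem (by omega))
    (fun k hk => Finset.mem_filter.mpr ⟨Finset.mem_univ _, hk⟩) Δ hΔ1 hΔ2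

open scoped Classical in
/-- **`hF` holds with the member finsets**: the canonical period pattern function `F(A) = Σ_m patternN a b_m A` is
`Σ_m f_m (A ∩ M_m)` with `M_m` the member finset of `b_m` (only members matter to `patternN`). -/
theorem canonical_period_eq_sum_inter {a : Dir} {T : ℝ} {F : Finset (Fin 28) → ℝ}
    (hF : ∀ A, F A = ∑ m ∈ Finset.range ((bkpts a T).card - 1), ((patternN a (bkpt a T m) A : ℤ) : ℝ)) (A : Finset (Fin 28)) :
    F A = ∑ m ∈ Finset.range ((bkpts a T).card - 1),
      ((patternN a (bkpt a T m) (A ∩ Finset.univ.filter fun k => ∃ z : ℤ, bkpt a T m * h28 a k = z) : ℤ) : ℝ) := by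
  rw [hF]
  refine Finset.sum_congr rfl fun m _ => ?_
  rw [patternN_inter_eq fun k hk => Finset.mem_filter.mpr ⟨Finset.mem_univ _, hk⟩]

/-- **`hspread` holds**: unit marginal spread of every canonical junction pattern function, on all pairs of patterns
(file (2), `patternN_spread_le_one`; the side conditions of the chain's hypothesis are not even needed). -/
theorem canonical_spread (a : Dir) (T : ℝ) (M : ℕ → Finset (Fin 28)) :
    ∀ m ∈ Finset.range ((bkpts a T).card - 1), ∀ S S' : Finset (Fin 28), S ⊆ M m → S' ⊆ M m → ∀ k ∈ M m,
      k ∉ S → k ∉ S' →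
        |(((patternN a (bkpt a T m) (insert k S) : ℤ) : ℝ) - ((patternN a (bkpt a T m) S : ℤ) : ℝ)) -
          (((patternN a (bkpt a T m) (insert k S') : ℤ) : ℝ) - ((patternN a (bkpt a T m) S' : ℤ) : ℝ))| ≤ 1 :=
  fun m _ S S' _ _ k _ _ _ => patternN_spread_le_one a (bkpt a T m) S S' k

open scoped Classical in
/-- The junction count of the chain (`#{m : k ∈ M m ∧ l ∈ M m}` with the member finsets) is the number of junctions of the
period at which both `k` and `l` are members. -/
theorem junctionCount_eq (a : Dir) (T : ℝ) (k l : Fin 28) :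
    ((Finset.range ((bkpts a T).card - 1)).filter fun m =>
        k ∈ (Finset.univ.filter fun k' => ∃ z : ℤ, bkpt a T m * h28 a k' = z) ∧
          l ∈ (Finset.univ.filter fun k' => ∃ z : ℤ, bkpt a T m * h28 a k' = z)) =
      (Finset.range ((bkpts a T).card - 1)).filter fun m =>
        (∃ z : ℤ, bkpt a T m * h28 a k = z) ∧ ∃ z : ℤ, bkpt a T m * h28 a l = z := by
  refine Finset.filter_congr fun m _ => ?_
  simp only [Finset.mem_filter, Finset.mem_univ, true_and]

open scoped Classical in
/-- **EVERY WALL DEFECT OF THE CANONICAL PERIOD PATTERN FUNCTION IS BOUNDED BY THE NUMBER OF JUNCTIONS ON THE WALL**: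
for `k ∉ S`, `k ≠ l`, `|F(S+k) + F(S+l) − F(S) − F(S+k+l)| ≤ #{m : b_m·h_k(a) ∈ ℤ ∧ b_m·h_l(a) ∈ ℤ}` — P2 g32's
`period_defect_abs_le_junctionCount` with its spread hypothesis discharged; realisable prefix or not. -/
theorem canonical_defect_abs_le_junctionCount {a : Dir} {T : ℝ} {F : Finset (Fin 28) → ℝ}
    (hF : ∀ A, F A = ∑ m ∈ Finset.range ((bkpts a T).card - 1), ((patternN a (bkpt a T m) A : ℤ) : ℝ))
    {S : Finset (Fin 28)} {k l : Fin 28} (hkS : k ∉ S) (hkl : k ≠ l) :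
    |F (insert k S) + F (insert l S) - F S - F (insert k (insert l S))| ≤
      (((Finset.range ((bkpts a T).card - 1)).filter fun m =>
        (∃ z : ℤ, bkpt a T m * h28 a k = z) ∧ ∃ z : ℤ, bkpt a T m * h28 a l = z).card : ℝ) := by
  have h := period_defect_abs_le_junctionCount
    (M := fun m => Finset.univ.filter fun k' => ∃ z : ℤ, bkpt a T m * h28 a k' = z)
    (f := fun m A => ((patternN a (bkpt a T m) A : ℤ) : ℝ)) (canonical_period_eq_sum_inter hF)
    (canonical_spread a T fun m => Finset.univ.filter fun k' => ∃ z : ℤ, bkpt a T m * h28 a k' = z) hkS hkl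
  simp only [junctionCount_eq] at h
  exact h

/-! ### The cusp slope is the Lovász extension of the canonical period pattern function -/

/-- **σ IS THE LOVÁSZ EXTENSION OF THE CANONICAL PERIOD PATTERN FUNCTION.** All 28 forms of `a` positive, `T > 0` a period,
`F(A) = Σ_{m<#bkpts−1} patternN a b_m A`. Then for every displacement `δ` and every weakly increasing chain
`−W = d_0 ≤ ⋯ ≤ d_n = W` through the 28 flip times `−φ_k(δ)/h_k(a)`:
`cuspSlope a T δ = −Σ_{0<i<n} d_i·(F(S_i) − F(S_{i−1}))`, `S_i = {k : −φ_k(δ)/h_k ≤ d_i}` — no pattern hypothesis left. -/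
theorem cuspSlope_eq_lovasz_canonical {a : Dir} (hpos : ∀ k, 0 < h28 a k) {T : ℝ} (hT : 0 < T)
    (hper : ∀ k : Fin 28, ∃ z : ℤ, T * h28 a k = z) {F : Finset (Fin 28) → ℝ}
    (hF : ∀ A, F A = ∑ m ∈ Finset.range ((bkpts a T).card - 1), ((patternN a (bkpt a T m) A : ℤ) : ℝ))
    (δ : Fin 8 → ℝ) {n : ℕ} {d : ℕ → ℝ} (hd0 : d 0 = -clusterWidth a δ) (hdn : d n = clusterWidth a δ)
    (hmono : ∀ j < n, d j ≤ d (j + 1)) (hflip : ∀ k, ∃ i ≤ n, d i = -(phiForm δ k / h28 a k)) :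
    cuspSlope a T δ =
      -∑ i ∈ Finset.Ico 1 n, d i *
        (F (Finset.univ.filter fun k => -(phiForm δ k / h28 a k) ≤ d i) -
          F (Finset.univ.filter fun k => -(phiForm δ k / h28 a k) ≤ d (i - 1))) := by
  classical
  exact cuspSlope_eq_lovasz_period hpos hT hper
    (M := fun m => Finset.univ.filter fun k => ∃ z : ℤ, bkpt a T m * h28 a k = z)
    (f := fun m A => ((patternN a (bkpt a T m) A : ℤ) : ℝ)) (canonical_junction_agreement a T) (canonical_period_eq_sum_inter hF)
    δ hd0 hdn hmono hflip

/-- **ON THE CLOSED CHAMBER OF A GENERIC REFERENCE, σ IS THE CANONICAL CHAMBER FUNCTIONAL**: if the 28 rates of `δ₀` are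
pairwise distinct and `δ` is refined by `δ₀`, then `cuspSlope a T δ = Σ_k (F(P≤(k)) − F(P<(k)))·φ_k(δ)/h_k(a)` with the
canonical `F` — the chamber weights `W_k(δ₀)` are 29 explicit values of the cell's saving formula. -/
theorem cuspSlope_eq_greedy_canonical_of_refines {a : Dir} (hpos : ∀ k, 0 < h28 a k) {T : ℝ} (hT : 0 < T)
    (hper : ∀ k : Fin 28, ∃ z : ℤ, T * h28 a k = z) {F : Finset (Fin 28) → ℝ}
    (hF : ∀ A, F A = ∑ m ∈ Finset.range ((bkpts a T).card - 1), ((patternN a (bkpt a T m) A : ℤ) : ℝ))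
    {δ₀ : Fin 8 → ℝ} (hgen : ∀ k l : Fin 28, k ≠ l → phiForm δ₀ k / h28 a k ≠ phiForm δ₀ l / h28 a l)
    (δ : Fin 8 → ℝ) (href : ∀ k l : Fin 28, phiForm δ k / h28 a k < phiForm δ l / h28 a l →
      phiForm δ₀ k / h28 a k < phiForm δ₀ l / h28 a l) :
    cuspSlope a T δ =
      ∑ k, (F (Finset.univ.filter fun l => phiForm δ₀ k / h28 a k ≤ phiForm δ₀ l / h28 a l) -
          F (Finset.univ.filter fun l => phiForm δ₀ k / h28 a k < phiForm δ₀ l / h28 a l)) *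
        (phiForm δ k / h28 a k) := by
  classical
  exact cuspSlope_eq_greedy_period_of_refines hpos hT hper
    (M := fun m => Finset.univ.filter fun k => ∃ z : ℤ, bkpt a T m * h28 a k = z)
    (f := fun m A => ((patternN a (bkpt a T m) A : ℤ) : ℝ)) (canonical_junction_agreement a T)
    (canonical_period_eq_sum_inter hF) hgen δ href

/-- **THE CANONICAL CHAMBER WEIGHTS ARE ORIENTED AND BOUNDED BY `T·h_k(a)`**: for a generic `δ₀`,
`0 ≤ W_k(δ₀) ≤ T·h_k(a)` for `k ∈ F` and `−T·h_k(a) ≤ W_k(δ₀) ≤ 0` for `k ∉ F`. -/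
theorem canonical_weight_bounds {a : Dir} (hpos : ∀ k, 0 < h28 a k) {T : ℝ} (hT : 0 < T)
    (hper : ∀ k : Fin 28, ∃ z : ℤ, T * h28 a k = z) {F : Finset (Fin 28) → ℝ}
    (hF : ∀ A, F A = ∑ m ∈ Finset.range ((bkpts a T).card - 1), ((patternN a (bkpt a T m) A : ℤ) : ℝ))
    {δ₀ : Fin 8 → ℝ} (hgen : ∀ k l : Fin 28, k ≠ l → phiForm δ₀ k / h28 a k ≠ phiForm δ₀ l / h28 a l) (k : Fin 28) :
    (k ∈ FIdx →
      0 ≤ F (Finset.univ.filter fun l => phiForm δ₀ k / h28 a k ≤ phiForm δ₀ l / h28 a l) -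
          F (Finset.univ.filter fun l => phiForm δ₀ k / h28 a k < phiForm δ₀ l / h28 a l) ∧
      F (Finset.univ.filter fun l => phiForm δ₀ k / h28 a k ≤ phiForm δ₀ l / h28 a l) -
          F (Finset.univ.filter fun l => phiForm δ₀ k / h28 a k < phiForm δ₀ l / h28 a l) ≤ T * h28 a k) ∧
    (k ∉ FIdx →
      -(T * h28 a k) ≤ F (Finset.univ.filter fun l => phiForm δ₀ k / h28 a k ≤ phiForm δ₀ l / h28 a l) -
          F (Finset.univ.filter fun l => phiForm δ₀ k / h28 a k < phiForm δ₀ l / h28 a l) ∧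
      F (Finset.univ.filter fun l => phiForm δ₀ k / h28 a k ≤ phiForm δ₀ l / h28 a l) -
          F (Finset.univ.filter fun l => phiForm δ₀ k / h28 a k < phiForm δ₀ l / h28 a l) ≤ 0) := by
  classical
  have hf := canonical_junction_agreement a T
  have hF' := canonical_period_eq_sum_inter hF
  have hb := period_weight_bounds hpos (T := T)
    (M := fun m => Finset.univ.filter fun k => ∃ z : ℤ, bkpt a T m * h28 a k = z)
    (f := fun m A => ((patternN a (bkpt a T m) A : ℤ) : ℝ)) hf hF' hgen k
  have habs := abs_le.mp (period_weight_abs_le hpos hT hper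
    (M := fun m => Finset.univ.filter fun k => ∃ z : ℤ, bkpt a T m * h28 a k = z)
    (f := fun m A => ((patternN a (bkpt a T m) A : ℤ) : ℝ)) (fun m _ k hk => (Finset.mem_filter.mp hk).2) hf hF' hgen k)
  exact ⟨fun hk => ⟨(hb.1 hk).1, habs.2⟩, fun hk => ⟨habs.1, (hb.2 hk).2⟩⟩

/-- **THE CANONICAL CHAMBER WEIGHTS ADD UP TO ZERO**: `Σ_k W_k(δ₀) = 0` for every generic `δ₀`. -/
theorem canonical_greedy_sum_eq_zero {a : Dir} (hpos : ∀ k, 0 < h28 a k) {T : ℝ} (hT : 0 < T)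
    (hper : ∀ k : Fin 28, ∃ z : ℤ, T * h28 a k = z) {F : Finset (Fin 28) → ℝ}
    (hF : ∀ A, F A = ∑ m ∈ Finset.range ((bkpts a T).card - 1), ((patternN a (bkpt a T m) A : ℤ) : ℝ))
    {δ₀ : Fin 8 → ℝ} (hgen : ∀ k l : Fin 28, k ≠ l → phiForm δ₀ k / h28 a k ≠ phiForm δ₀ l / h28 a l) :
    ∑ k, (F (Finset.univ.filter fun l => phiForm δ₀ k / h28 a k ≤ phiForm δ₀ l / h28 a l) -
        F (Finset.univ.filter fun l => phiForm δ₀ k / h28 a k < phiForm δ₀ l / h28 a l)) = 0 := by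
  classical
  exact period_greedy_sum_eq_zero hpos hT hper
    (M := fun m => Finset.univ.filter fun k => ∃ z : ℤ, bkpt a T m * h28 a k = z)
    (f := fun m A => ((patternN a (bkpt a T m) A : ℤ) : ℝ)) (canonical_junction_agreement a T) (canonical_period_eq_sum_inter hF) hgen

/-! ### The junction-count gauge with no structural hypothesis -/

open scoped Classical in
/-- **THE JUNCTION-COUNT GAUGE, UPPER SIDE — NO STRUCTURAL HYPOTHESIS.** All 28 forms of `a` positive, `T > 0` a period,
`F` the canonical period pattern function. For every reference `δ₀` with pairwise distinct rates `ρ_k = φ_k(δ₀)/h_k(a)` and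
EVERY displacement `δ`:
`cuspSlope a T δ ≤ Σ_k W_k(δ₀)·r_k(δ) + Σ_{ρ_k<ρ_l} J_{kl}·max(r_k(δ) − r_l(δ), 0)`,
`J_{kl} = #{m < #bkpts−1 : b_m·h_k(a) ∈ ℤ ∧ b_m·h_l(a) ∈ ℤ}` (P2 g32's `cuspSlope_le_greedy_add_countGauge` with `hf`, `hF`,
`hspread` discharged by files (1)–(2)). -/
theorem cuspSlope_le_greedy_add_countGauge_canonical {a : Dir} (hpos : ∀ k, 0 < h28 a k) {T : ℝ} (hT : 0 < T)
    (hper : ∀ k : Fin 28, ∃ z : ℤ, T * h28 a k = z) {F : Finset (Fin 28) → ℝ}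
    (hF : ∀ A, F A = ∑ m ∈ Finset.range ((bkpts a T).card - 1), ((patternN a (bkpt a T m) A : ℤ) : ℝ))
    {δ₀ : Fin 8 → ℝ} (hgen : ∀ k l : Fin 28, k ≠ l → phiForm δ₀ k / h28 a k ≠ phiForm δ₀ l / h28 a l)
    (δ : Fin 8 → ℝ) :
    cuspSlope a T δ ≤
      ∑ k, (F (Finset.univ.filter fun l => phiForm δ₀ k / h28 a k ≤ phiForm δ₀ l / h28 a l) -
          F (Finset.univ.filter fun l => phiForm δ₀ k / h28 a k < phiForm δ₀ l / h28 a l)) *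
        (phiForm δ k / h28 a k) +
      ∑ k, ∑ l, if phiForm δ₀ k / h28 a k < phiForm δ₀ l / h28 a l then
        ((((Finset.range ((bkpts a T).card - 1)).filter fun m =>
            (∃ z : ℤ, bkpt a T m * h28 a k = z) ∧ ∃ z : ℤ, bkpt a T m * h28 a l = z).card : ℕ) : ℝ) *
          max (phiForm δ k / h28 a k - phiForm δ l / h28 a l) 0 else 0 := by
  have h := cuspSlope_le_greedy_add_countGauge hpos hT hper
    (M := fun m => Finset.univ.filter fun k => ∃ z : ℤ, bkpt a T m * h28 a k = z)
    (f := fun m A => ((patternN a (bkpt a T m) A : ℤ) : ℝ)) (canonical_junction_agreement a T)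
    (canonical_period_eq_sum_inter hF)
    (canonical_spread a T fun m => Finset.univ.filter fun k' => ∃ z : ℤ, bkpt a T m * h28 a k' = z) hgen δ
  simp only [junctionCount_eq] at h
  exact h

open scoped Classical in
/-- **THE JUNCTION-COUNT GAUGE, LOWER SIDE — NO STRUCTURAL HYPOTHESIS**:
`Σ_k W_k(δ₀)·r_k(δ) − Σ_{ρ_k<ρ_l} J_{kl}·max(r_k(δ) − r_l(δ), 0) ≤ cuspSlope a T δ`. Together with the upper side:
`|σ(δ) − G_{δ₀}(δ)| ≤ Σ_{walls inverted between δ₀ and δ} J_{kl}·|r_k(δ) − r_l(δ)|` for every `δ₀` generic and every `δ`. -/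
theorem greedy_sub_countGauge_le_cuspSlope_canonical {a : Dir} (hpos : ∀ k, 0 < h28 a k) {T : ℝ} (hT : 0 < T)
    (hper : ∀ k : Fin 28, ∃ z : ℤ, T * h28 a k = z) {F : Finset (Fin 28) → ℝ}
    (hF : ∀ A, F A = ∑ m ∈ Finset.range ((bkpts a T).card - 1), ((patternN a (bkpt a T m) A : ℤ) : ℝ))
    {δ₀ : Fin 8 → ℝ} (hgen : ∀ k l : Fin 28, k ≠ l → phiForm δ₀ k / h28 a k ≠ phiForm δ₀ l / h28 a l)
    (δ : Fin 8 → ℝ) :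
    ∑ k, (F (Finset.univ.filter fun l => phiForm δ₀ k / h28 a k ≤ phiForm δ₀ l / h28 a l) -
          F (Finset.univ.filter fun l => phiForm δ₀ k / h28 a k < phiForm δ₀ l / h28 a l)) *
        (phiForm δ k / h28 a k) -
      ∑ k, ∑ l, (if phiForm δ₀ k / h28 a k < phiForm δ₀ l / h28 a l then
        ((((Finset.range ((bkpts a T).card - 1)).filter fun m =>
            (∃ z : ℤ, bkpt a T m * h28 a k = z) ∧ ∃ z : ℤ, bkpt a T m * h28 a l = z).card : ℕ) : ℝ) *
          max (phiForm δ k / h28 a k - phiForm δ l / h28 a l) 0 else 0) ≤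
      cuspSlope a T δ := by
  have h := greedy_sub_countGauge_le_cuspSlope hpos hT hper
    (M := fun m => Finset.univ.filter fun k => ∃ z : ℤ, bkpt a T m * h28 a k = z)
    (f := fun m A => ((patternN a (bkpt a T m) A : ℤ) : ℝ)) (canonical_junction_agreement a T)
    (canonical_period_eq_sum_inter hF)
    (canonical_spread a T fun m => Finset.univ.filter fun k' => ∃ z : ℤ, bkpt a T m * h28 a k' = z) hgen δ
  simp only [junctionCount_eq] at h
  exact h

open scoped Classical in
/-- **THE NO-ASCENT CONE CERTIFICATE — NO STRUCTURAL HYPOTHESIS.** All 28 forms of `a` positive, `T > 0` a period, `F` the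
canonical period pattern function, `δ₀` a generic reference, `g_j` (`j ∈ s`) finitely many generators at each of which the
junction-count majorant is `≤ 0`:
`Σ_k W_k(δ₀)·r_k(g_j) + Σ_{ρ_k<ρ_l} J_{kl}·max(r_k(g_j) − r_l(g_j), 0) ≤ 0`. Then `cuspSlope a T (Σ_{j∈s} t_j • g_j) ≤ 0` for
every `t ≥ 0` — finitely many rational checks on the cell's own objects certify «no ascent direction inside the cone». -/
theorem cuspSlope_nonpos_on_cone_of_generators_canonical {a : Dir} (hpos : ∀ k, 0 < h28 a k) {T : ℝ} (hT : 0 < T)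
    (hper : ∀ k : Fin 28, ∃ z : ℤ, T * h28 a k = z) {F : Finset (Fin 28) → ℝ}
    (hF : ∀ A, F A = ∑ m ∈ Finset.range ((bkpts a T).card - 1), ((patternN a (bkpt a T m) A : ℤ) : ℝ))
    {δ₀ : Fin 8 → ℝ} (hgen : ∀ k l : Fin 28, k ≠ l → phiForm δ₀ k / h28 a k ≠ phiForm δ₀ l / h28 a l)
    {ι : Type*} (s : Finset ι) (g : ι → Fin 8 → ℝ)
    (hcert : ∀ j ∈ s,
      ∑ k, (F (Finset.univ.filter fun l => phiForm δ₀ k / h28 a k ≤ phiForm δ₀ l / h28 a l) -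
          F (Finset.univ.filter fun l => phiForm δ₀ k / h28 a k < phiForm δ₀ l / h28 a l)) *
        (phiForm (g j) k / h28 a k) +
      ∑ k, ∑ l, (if phiForm δ₀ k / h28 a k < phiForm δ₀ l / h28 a l then
        ((((Finset.range ((bkpts a T).card - 1)).filter fun m =>
            (∃ z : ℤ, bkpt a T m * h28 a k = z) ∧ ∃ z : ℤ, bkpt a T m * h28 a l = z).card : ℕ) : ℝ) *
          max (phiForm (g j) k / h28 a k - phiForm (g j) l / h28 a l) 0 else 0) ≤ 0)
    (t : ι → ℝ) (ht : ∀ j ∈ s, 0 ≤ t j) :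
    cuspSlope a T (∑ j ∈ s, t j • g j) ≤ 0 := by
  have h := cuspSlope_nonpos_on_cone_of_generators_count hpos hT hper
    (M := fun m => Finset.univ.filter fun k => ∃ z : ℤ, bkpt a T m * h28 a k = z)
    (f := fun m A => ((patternN a (bkpt a T m) A : ℤ) : ℝ)) (canonical_junction_agreement a T)
    (canonical_period_eq_sum_inter hF)
    (canonical_spread a T fun m => Finset.univ.filter fun k' => ∃ z : ℤ, bkpt a T m * h28 a k' = z) hgen s g
  simp only [junctionCount_eq] at h
  exact h hcert t ht

end Summit.KontsevichZagierPeriods.Zeta5Search.Barrier.ConeGamma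

end
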